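import Summits.KontsevichZagierPeriods.KontsevichZagierPeriods.Theorems.LiouvilleUnfoldingLogPrimitiveNLStubAbstractLogLinearAux

/-!
# Abstract log-linear rigidity (stub `stub_abstractLogLinear`, line `ax-schanuel-germs`)

Support for crux `LiouvilleUnfolding.LogPrimitiveNL` (stmt-KontsevichZagierPeriods-2836).
Pure differential algebra: over a field `L` of characteristic `0` with a derivation `D` and a
`D`-stable subfield `F` containing the constants and having the Rosenlicht property, a relation
`Σ ηᵢ yᵢ = g` (`ηᵢ, g ∈ F`, `D yᵢ = D wᵢ / wᵢ`, `wᵢ ∈ Fˣ`) forces `Σ pᵢ ηᵢ = 0` for every integer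
vector `p` orthogonal to the lattice `{f ∈ ℤᵏ | D (Σ fᵢ yᵢ) = 0}`. Proof by induction on `k`:
if the lattice is trivial, Kolchin–Ostrowski differentiation makes the coefficients of a normalised
relation constant and the Rosenlicht upgrade (`exists_lattice_ne_zero`) produces a non-zero lattice
vector, a contradiction, so the relation is trivial; otherwise a lattice vector eliminates one `yᵢ`.
Conjunct (2) (real double-orthogonal lemma) is `real_double_orthogonal` from the auxiliary file.
-/

noncomputable section

open Set MeasureTheory Filter
open scoped ContDiff Topology LaurentSeries RatFunc

namespace Summit.KontsevichZagierPeriods.LiouvilleUnfolding.LogPrimitiveNL.AxSchanuelGerms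

/-! ## Part 1: abstract log-linear rigidity -/

section PartOne

variable {L : Type} [Field L] [CharZero L] (D : Derivation ℤ L L) (F : Subfield L)

omit [CharZero L] in
/-- A vector orthogonal to the lattice of `y` restricts to a vector orthogonal to the lattice of the
subsystem `y ∘ i.succAbove` (zero-extension embeds the latter lattice into the former). -/
theorem orth_succAbove {k : ℕ} (y : Fin (k + 1) → L) (i : Fin (k + 1)) (p : Fin (k + 1) → ℤ)
    (hp : ∀ f : Fin (k + 1) → ℤ, D (∑ l, (f l : L) * y l) = 0 → ∑ l, p l * f l = 0)
    (f : Fin k → ℤ) (hf : D (∑ j, (f j : L) * y (i.succAbove j)) = 0) :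
    ∑ j, p (i.succAbove j) * f j = 0 := by
  rw [← sum_mul_insertNth i f p]
  apply hp
  rw [sum_cast_insertNth_mul]
  exact hf

/-- **Rosenlicht upgrade.** If `Σᵢ (Σₜ nᵢₜ eₜ) yᵢ ∈ F` with `eₜ` `ℚ`-independent constants and
integers `nᵢₜ`, then every column `n·ₜ` is in the lattice: `D (Σᵢ nᵢₜ yᵢ) = 0` (apply the Rosenlicht
property to the monomials `uₜ = ∏ᵢ wᵢ ^ nᵢₜ`, whose logarithmic derivatives are `D (Σᵢ nᵢₜ yᵢ)`). -/
theorem lattice_of_int_coords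
    (hR : ∀ (m : ℕ) (c u : Fin m → L) (v : L), (∀ j, D (c j) = 0) → LinearIndependent ℚ c →
      (∀ j, u j ∈ F) → (∀ j, u j ≠ 0) → v ∈ F →
      (∑ j, c j * ((u j)⁻¹ * D (u j))) + D v = 0 → ∀ j, D (u j) = 0)
    {k m : ℕ} (w y : Fin k → L) (hw : ∀ i, w i ∈ F) (hw0 : ∀ i, w i ≠ 0)
    (hy : ∀ i, D (y i) = (w i)⁻¹ * D (w i)) (e : Fin m → L) (he : LinearIndependent ℚ e)
    (he0 : ∀ t, D (e t) = 0) (n : Fin k → Fin m → ℤ) (b : L) (hb : b ∈ F)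
    (hrel : ∑ i, (∑ t, (n i t : L) * e t) * y i = b) :
    ∀ t, D (∑ i, (n i t : L) * y i) = 0 := by
  set u : Fin m → L := fun t => ∏ i, w i ^ n i t with hu_def
  have hu : ∀ t, u t ∈ F := fun t => prod_mem fun i _ => zpow_mem (hw i) _
  have hu0 : ∀ t, u t ≠ 0 := fun t => Finset.prod_ne_zero_iff.mpr fun i _ => zpow_ne_zero _ (hw0 i)
  have hlog : ∀ t, (u t)⁻¹ * D (u t) = D (∑ i, (n i t : L) * y i) := fun t => by
    rw [hu_def, inv_mul_deriv_prod_zpow D w hw0, deriv_sum_intCast_mul]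
    simp only [hy]
  have hDb : D b = ∑ t, e t * ((u t)⁻¹ * D (u t)) := by
    rw [← hrel]
    have : ∑ i, (∑ t, (n i t : L) * e t) * y i = ∑ t, e t * ∑ i, (n i t : L) * y i := by
      simp only [Finset.sum_mul, Finset.mul_sum]
      rw [Finset.sum_comm]
      exact Finset.sum_congr rfl fun t _ => Finset.sum_congr rfl fun i _ => by ring
    rw [this, map_sum]
    refine Finset.sum_congr rfl fun t _ => ?_
    rw [Derivation.leibniz, he0, smul_zero, add_zero, smul_eq_mul, hlog]
  have key := hR m e u (-b) he0 he hu hu0 (neg_mem hb) (by rw [map_neg, hDb, add_neg_cancel])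
  intro t
  rw [← hlog, key t, mul_zero]

/-- **Constant relations give lattice vectors.** A non-zero constant-coefficient relation
`Σ cᵢ yᵢ ∈ F` yields a non-zero integer vector in the lattice `{f | D (Σ fᵢ yᵢ) = 0}` (integer
coordinates of `c` over a `ℚ`-basis, then the Rosenlicht upgrade). -/
theorem exists_lattice_ne_zero
    (hR : ∀ (m : ℕ) (c u : Fin m → L) (v : L), (∀ j, D (c j) = 0) → LinearIndependent ℚ c →
      (∀ j, u j ∈ F) → (∀ j, u j ≠ 0) → v ∈ F →
      (∑ j, c j * ((u j)⁻¹ * D (u j))) + D v = 0 → ∀ j, D (u j) = 0)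
    {k : ℕ} (w y : Fin k → L) (hw : ∀ i, w i ∈ F) (hw0 : ∀ i, w i ≠ 0)
    (hy : ∀ i, D (y i) = (w i)⁻¹ * D (w i)) (c : Fin k → L) (hc0 : ∀ i, D (c i) = 0) (hc : c ≠ 0)
    (b : L) (hb : b ∈ F) (hrel : ∑ i, c i * y i = b) :
    ∃ f : Fin k → ℤ, D (∑ i, (f i : L) * y i) = 0 ∧ f ≠ 0 := by
  obtain ⟨m, e, n, N, hN, hli, he, hce⟩ := exists_int_coords c
  have he0 : ∀ t, D (e t) = 0 := fun t => by
    obtain ⟨i, hi⟩ := he t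
    rw [hi]
    exact hc0 i
  have hrel' : ∑ i, (∑ t, (n i t : L) * e t) * y i = N * b := by
    rw [← hrel, Finset.mul_sum]
    exact Finset.sum_congr rfl fun i _ => by rw [← hce, mul_assoc]
  have hcol := lattice_of_int_coords D F hR w y hw hw0 hy e hli he0 n (N * b)
    (mul_mem (natCast_mem F N) hb) hrel'
  obtain ⟨i, hi⟩ := Function.ne_iff.mp hc
  have hNc : (N : L) * c i ≠ 0 := mul_ne_zero (Nat.cast_ne_zero.mpr hN.ne') hi
  rw [hce] at hNc
  obtain ⟨t, ht⟩ : ∃ t, n i t ≠ 0 := by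
    by_contra h
    push Not at h
    exact hNc (Finset.sum_eq_zero fun t _ => by rw [h t, Int.cast_zero, zero_mul])
  exact ⟨fun i => n i t, hcol t, fun h0 => ht (by simpa using congrFun h0 i)⟩

/-- **Induction step, degenerate case** (Kolchin–Ostrowski): if the lattice of `y` is trivial and
the rigidity statement holds for the subsystems `y ∘ i.succAbove`, then every relation
`Σ ηᵢ yᵢ = g` over `F` is trivial (normalise one coefficient to `1`, differentiate, conclude that
the coefficients are constants, and contradict `exists_lattice_ne_zero`). -/
theorem step_zero (hF : ∀ x ∈ F, D x ∈ F)
    (hR : ∀ (m : ℕ) (c u : Fin m → L) (v : L), (∀ j, D (c j) = 0) → LinearIndependent ℚ c →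
      (∀ j, u j ∈ F) → (∀ j, u j ≠ 0) → v ∈ F →
      (∑ j, c j * ((u j)⁻¹ * D (u j))) + D v = 0 → ∀ j, D (u j) = 0)
    {k : ℕ}
    (ih : ∀ (η w y : Fin k → L) (g : L), (∀ i, η i ∈ F) → (∀ i, w i ∈ F) →
      (∀ i, w i ≠ 0) → (∀ i, D (y i) = (w i)⁻¹ * D (w i)) → g ∈ F →
      ∑ i, η i * y i = g →
      ∀ p : Fin k → ℤ,
        (∀ f : Fin k → ℤ, D (∑ i, (f i : L) * y i) = 0 → ∑ i, p i * f i = 0) →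
        ∑ i, (p i : L) * η i = 0)
    (η w y : Fin (k + 1) → L) (g : L) (hη : ∀ i, η i ∈ F) (hw : ∀ i, w i ∈ F)
    (hw0 : ∀ i, w i ≠ 0) (hy : ∀ i, D (y i) = (w i)⁻¹ * D (w i)) (hg : g ∈ F)
    (hrel : ∑ i, η i * y i = g)
    (hΛ : ∀ f : Fin (k + 1) → ℤ, D (∑ i, (f i : L) * y i) = 0 → f = 0) : η = 0 := by
  by_contra hne
  obtain ⟨i₀, hi₀⟩ : ∃ i, η i ≠ 0 := Function.ne_iff.mp hne
  -- normalise the relation at `i₀`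
  set a : Fin (k + 1) → L := fun i => η i / η i₀ with ha_def
  have ha : ∀ i, a i ∈ F := fun i => div_mem (hη i) (hη i₀)
  have hai₀ : a i₀ = 1 := div_self hi₀
  have hrel_a : ∑ i, a i * y i = g / η i₀ := by
    simp only [ha_def, div_mul_eq_mul_div, ← Finset.sum_div, hrel]
  -- differentiate it
  set g₂ : L := D (g / η i₀) - ∑ i, a i * ((w i)⁻¹ * D (w i)) with hg₂_def
  have hg₂ : g₂ ∈ F := sub_mem (hF _ (div_mem hg (hη i₀)))
    (sum_mem fun i _ => mul_mem (ha i) (mul_mem (inv_mem (hw i)) (hF _ (hw i))))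
  have hDrel : ∑ i, D (a i) * y i = g₂ := by
    have h := congrArg D hrel_a
    rw [map_sum] at h
    simp only [Derivation.leibniz, hy, smul_eq_mul] at h
    rw [Finset.sum_add_distrib] at h
    rw [hg₂_def, ← h, add_sub_cancel_left]
    exact Finset.sum_congr rfl fun i _ => mul_comm _ _
  -- the `i₀`-th coefficient is `D 1 = 0`: a relation for the subsystem
  have hsub : ∑ j, D (a (i₀.succAbove j)) * y (i₀.succAbove j) = g₂ := by
    rw [← hDrel, Fin.sum_univ_succAbove _ i₀, hai₀, Derivation.map_one_eq_zero, zero_mul, zero_add]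
  -- the lattice of the subsystem is trivial as well
  have horth : ∀ (p' f' : Fin k → ℤ), D (∑ j, (f' j : L) * y (i₀.succAbove j)) = 0 →
      ∑ j, p' j * f' j = 0 := fun p' f' hf' => by
    have h0 : (Fin.insertNth i₀ (0 : ℤ) f' : Fin (k + 1) → ℤ) = 0 :=
      hΛ _ (by rw [sum_cast_insertNth_mul]; exact hf')
    have : f' = 0 := funext fun j => by
      simpa [Fin.insertNth_apply_succAbove] using congrFun h0 (i₀.succAbove j)
    simp [this]
  have hDa : ∀ j, D (a (i₀.succAbove j)) = 0 := fun j => by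
    have h := ih (fun j => D (a (i₀.succAbove j))) (fun j => w (i₀.succAbove j))
      (fun j => y (i₀.succAbove j)) g₂ (fun j => hF _ (ha _)) (fun j => hw _) (fun j => hw0 _)
      (fun j => hy _) hg₂ hsub (Pi.single j 1) (fun f' hf' => horth _ f' hf')
    simpa [Pi.single_apply] using h
  have hDa' : ∀ i, D (a i) = 0 := fun i => by
    rcases Fin.eq_self_or_eq_succAbove i₀ i with rfl | ⟨j, rfl⟩
    · rw [hai₀, Derivation.map_one_eq_zero]
    · exact hDa j
  have ha0 : a ≠ 0 := fun h => one_ne_zero (by rw [← hai₀, h]; rfl)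
  obtain ⟨f, hfΛ, hf0⟩ :=
    exists_lattice_ne_zero D F hR w y hw hw0 hy a hDa' ha0 (g / η i₀) (div_mem hg (hη i₀)) hrel_a
  exact hf0 (hΛ f hfΛ)

/-- **Induction step, elimination case**: a lattice vector `f` with `f i₁ ≠ 0` eliminates `y i₁`
(`Σ fᵢ yᵢ` is a constant, hence in `F`), and the rigidity statement for the subsystem
`y ∘ i₁.succAbove` gives it for `y`. -/
theorem step_elim (hC : ∀ x, D x = 0 → x ∈ F) {k : ℕ}
    (ih : ∀ (η w y : Fin k → L) (g : L), (∀ i, η i ∈ F) → (∀ i, w i ∈ F) →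
      (∀ i, w i ≠ 0) → (∀ i, D (y i) = (w i)⁻¹ * D (w i)) → g ∈ F →
      ∑ i, η i * y i = g →
      ∀ p : Fin k → ℤ,
        (∀ f : Fin k → ℤ, D (∑ i, (f i : L) * y i) = 0 → ∑ i, p i * f i = 0) →
        ∑ i, (p i : L) * η i = 0)
    (η w y : Fin (k + 1) → L) (g : L) (hη : ∀ i, η i ∈ F) (hw : ∀ i, w i ∈ F)
    (hw0 : ∀ i, w i ≠ 0) (hy : ∀ i, D (y i) = (w i)⁻¹ * D (w i)) (hg : g ∈ F)
    (hrel : ∑ i, η i * y i = g) (f : Fin (k + 1) → ℤ) (hfΛ : D (∑ i, (f i : L) * y i) = 0)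
    (i₁ : Fin (k + 1)) (hi₁ : f i₁ ≠ 0) (p : Fin (k + 1) → ℤ)
    (hp : ∀ f' : Fin (k + 1) → ℤ, D (∑ i, (f' i : L) * y i) = 0 → ∑ i, p i * f' i = 0) :
    ∑ i, (p i : L) * η i = 0 := by
  obtain ⟨κ, hκ_def⟩ : ∃ κ : L, κ = ∑ i, (f i : L) * y i := ⟨_, rfl⟩
  have hκ : κ ∈ F := hκ_def ▸ hC _ hfΛ
  have hf1 : (f i₁ : L) ≠ 0 := Int.cast_ne_zero.mpr hi₁
  have hκ' : κ = (f i₁ : L) * y i₁ + ∑ j, (f (i₁.succAbove j) : L) * y (i₁.succAbove j) := by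
    rw [hκ_def, Fin.sum_univ_succAbove _ i₁]
  -- new coefficients and right-hand side
  set η' : Fin k → L := fun j => η (i₁.succAbove j) - η i₁ * (f (i₁.succAbove j) : L) / f i₁
    with hη'_def
  have hη' : ∀ j, η' j ∈ F := fun j =>
    sub_mem (hη _) (div_mem (mul_mem (hη _) (intCast_mem F _)) (intCast_mem F _))
  have hg' : g - η i₁ * κ / f i₁ ∈ F := sub_mem hg (div_mem (mul_mem (hη _) hκ) (intCast_mem F _))
  have hrel' : ∑ j, η' j * y (i₁.succAbove j) = g - η i₁ * κ / f i₁ := by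
    have hy1 : y i₁ = (κ - ∑ j, (f (i₁.succAbove j) : L) * y (i₁.succAbove j)) / f i₁ := by
      rw [eq_div_iff hf1]
      linear_combination -hκ'
    rw [Fin.sum_univ_succAbove _ i₁] at hrel
    have e2 : ∑ j, η' j * y (i₁.succAbove j) = ∑ j, η (i₁.succAbove j) * y (i₁.succAbove j) -
        η i₁ / f i₁ * ∑ j, (f (i₁.succAbove j) : L) * y (i₁.succAbove j) := by
      rw [Finset.mul_sum, ← Finset.sum_sub_distrib]
      refine Finset.sum_congr rfl fun j _ => ?_
      rw [hη'_def]
      field_simp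
    rw [e2, ← hrel, hy1]
    field_simp
    ring
  have h1 := ih η' (fun j => w (i₁.succAbove j)) (fun j => y (i₁.succAbove j)) (g - η i₁ * κ / f i₁)
    hη' (fun j => hw _) (fun j => hw0 _) (fun j => hy _) hg' hrel' (fun j => p (i₁.succAbove j))
    (fun f' hf' => orth_succAbove D y i₁ p hp f' hf')
  have h2 : (p i₁ : L) * f i₁ + ∑ j, (p (i₁.succAbove j) : L) * f (i₁.succAbove j) = 0 := by
    have := congrArg (Int.cast : ℤ → L) (hp f (hκ_def ▸ hfΛ))
    push_cast at this
    rwa [Fin.sum_univ_succAbove _ i₁] at this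
  have e3 : ∑ j, (p (i₁.succAbove j) : L) * η (i₁.succAbove j) =
      ∑ j, (p (i₁.succAbove j) : L) * η' j +
        η i₁ / f i₁ * ∑ j, (p (i₁.succAbove j) : L) * f (i₁.succAbove j) := by
    rw [Finset.mul_sum, ← Finset.sum_add_distrib]
    refine Finset.sum_congr rfl fun j _ => ?_
    rw [hη'_def]
    field_simp
    ring
  have e4 : ∑ j, (p (i₁.succAbove j) : L) * f (i₁.succAbove j) = -((p i₁ : L) * f i₁) := by
    linear_combination h2
  rw [Fin.sum_univ_succAbove _ i₁, e3, h1, zero_add, e4]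
  field_simp
  ring

/-- **Abstract log-linear rigidity** (conjunct (1) of the stub), by induction on `k`. -/
theorem abstract_logLinear (hF : ∀ x ∈ F, D x ∈ F) (hC : ∀ x, D x = 0 → x ∈ F)
    (hR : ∀ (m : ℕ) (c u : Fin m → L) (v : L), (∀ j, D (c j) = 0) → LinearIndependent ℚ c →
      (∀ j, u j ∈ F) → (∀ j, u j ≠ 0) → v ∈ F →
      (∑ j, c j * ((u j)⁻¹ * D (u j))) + D v = 0 → ∀ j, D (u j) = 0) :
    ∀ (k : ℕ) (η w y : Fin k → L) (g : L), (∀ i, η i ∈ F) → (∀ i, w i ∈ F) →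
      (∀ i, w i ≠ 0) → (∀ i, D (y i) = (w i)⁻¹ * D (w i)) → g ∈ F →
      ∑ i, η i * y i = g →
      ∀ p : Fin k → ℤ,
        (∀ f : Fin k → ℤ, D (∑ i, (f i : L) * y i) = 0 → ∑ i, p i * f i = 0) →
        ∑ i, (p i : L) * η i = 0 := by
  intro k
  induction k with
  | zero =>
    intros
    simp
  | succ k ih =>
    intro η w y g hη hw hw0 hy hg hrel p hp
    by_cases hΛ : ∀ f : Fin (k + 1) → ℤ, D (∑ i, (f i : L) * y i) = 0 → f = 0
    · rw [step_zero D F hF hR ih η w y g hη hw hw0 hy hg hrel hΛ]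
      simp
    · push Not at hΛ
      obtain ⟨f, hfΛ, hf⟩ := hΛ
      obtain ⟨i₁, hi₁⟩ := Function.ne_iff.mp hf
      exact step_elim D F hC ih η w y g hη hw hw0 hy hg hrel f hfΛ i₁ hi₁ p hp

end PartOne

/-- **Abstract log-linear rigidity** (linear shadow of Ax–Schanuel, dual form; pure differential
algebra) and the real double-orthogonal lemma. (1) `L` a field of characteristic `0` with a
derivation `D`, `F` a `D`-stable subfield containing the constants and having the Rosenlicht
property; `ηᵢ, g ∈ F`, `wᵢ ∈ F` non-zero, `D yᵢ = D wᵢ / wᵢ`, `Σ ηᵢ yᵢ = g`. Then `Σ pᵢ ηᵢ = 0` for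
every `p ∈ ℤᵏ` orthogonal to the lattice `Λ = {f ∈ ℤᵏ | D (Σ fᵢ yᵢ) = 0}` (Kolchin–Ostrowski
differentiation to constant coefficients, Rosenlicht to integer exponents, induction on `k`).
(2) For a set `S ⊆ ℤᵏ`, a real vector orthogonal to every integer vector orthogonal to `S` lies in
the real span of `S`. -/
theorem stub_abstractLogLinear :
    (∀ (L : Type) [Field L] [CharZero L] (D : Derivation ℤ L L) (F : Subfield L),
      (∀ x ∈ F, D x ∈ F) → (∀ x, D x = 0 → x ∈ F) →
      (∀ (m : ℕ) (c u : Fin m → L) (v : L), (∀ j, D (c j) = 0) → LinearIndependent ℚ c →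
        (∀ j, u j ∈ F) → (∀ j, u j ≠ 0) → v ∈ F →
        (∑ j, c j * ((u j)⁻¹ * D (u j))) + D v = 0 → ∀ j, D (u j) = 0) →
      ∀ (k : ℕ) (η w y : Fin k → L) (g : L), (∀ i, η i ∈ F) → (∀ i, w i ∈ F) →
        (∀ i, w i ≠ 0) → (∀ i, D (y i) = (w i)⁻¹ * D (w i)) → g ∈ F →
        ∑ i, η i * y i = g →
        ∀ p : Fin k → ℤ,
          (∀ f : Fin k → ℤ, D (∑ i, (f i : L) * y i) = 0 → ∑ i, p i * f i = 0) →
          ∑ i, (p i : L) * η i = 0) ∧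
    (∀ (k : ℕ) (S : Set (Fin k → ℤ)) (v : Fin k → ℝ),
      (∀ p : Fin k → ℤ, (∀ f ∈ S, ∑ i, p i * f i = 0) → ∑ i, (p i : ℝ) * v i = 0) →
      v ∈ Submodule.span ℝ {φ : Fin k → ℝ | ∃ f ∈ S, φ = fun i => (f i : ℝ)}) :=
  ⟨fun _ _ _ D F hF hC hR => abstract_logLinear D F hF hC hR,
    real_double_orthogonal⟩

end Summit.KontsevichZagierPeriods.LiouvilleUnfolding.LogPrimitiveNL.AxSchanuelGerms

end
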